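import Mathlib.CategoryTheory.Triangulated.Pretriangulated
import Mathlib.Algebra.Ring.NegOnePow
import HarnessLib

/-!
# Obstructions factor through connecting morphisms (LEMMA GBC) and the Koszul-pair injectivity step

Cell `pub-hsemireg`, track S4-PUSH corner 1 (s4-search-1 g6). HONEST FRAMING: three formal lemmas about a
pretriangulated category `C` and a family of morphisms `ob X : X ⟶ X⟦2⟧` that is natural in `X` (the model is
`ob_E = (id ⊗ κ) ∘ At(E)`, the obstruction to lifting `E` along a first-order deformation `κ`, Huybrechts–Thomas,
Math. Ann. 346 (2010), Cor. 3.4). They are the categorical core of THEOREM KP of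
`s4push/search-1/ZSEARCH-NOTE-search-1.md` §12 / `THEOREM-KP-search-1.md` (the Koszul-pair obstruction theorem);
the geometric inputs of that theorem (index-12 vanishings, the structure of the explicit complexes) are NOT
formalised here and are not claimed. Nothing in this file is a statement about any variety, and nothing here
bears on HC / HC_CM / HC_AV.

The natural family is passed as two explicit hypotheses `ob` and `hob` (no new definitions in this file).

* `ob_factors_through_connecting` (LEMMA GBC): for a distinguished triangle `V ⟶ G ⟶ Q ⟶ V⟦1⟧`, if `ob G = 0`
  then `ob Q` factors through the connecting morphism `Q ⟶ V⟦1⟧`.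
* `ob_summand_eq_of_factors` (block extraction): if `ob Q = Θ ≫ ζ` and a direct summand `J` of `Q` meets `Θ`
  only through `κ : J ⟶ K` and through an object `W` with `Hom(W, J⟦2⟧) = 0`, then `ob J = κ ≫ _`.
* `ob_eq_zero_of_pair` (steps (3)–(4) of THEOREM KP): for a distinguished triangle `V ⟶ F ⟶ J ⟶ V⟦1⟧` with
  `Hom(F, V⟦2⟧) = 0`, if `ob J` factors through `J ⟶ V⟦1⟧` then `ob F = 0`.
-/

namespace Summit.Ventures.HSemireg.KoszulPairObstruction

open CategoryTheory CategoryTheory.Limits CategoryTheory.Pretriangulated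

universe v u

variable {C : Type u} [Category.{v} C] [Preadditive C] [HasZeroObject C] [HasShift C ℤ]
  [∀ n : ℤ, (shiftFunctor C n).Additive] [Pretriangulated C]

/-- **LEMMA GBC.** For a natural family `ob X : X ⟶ X⟦2⟧` and a distinguished triangle
`V ⟶ G ⟶ Q ⟶ V⟦1⟧`: if `ob G = 0`, then `ob Q` factors through the connecting morphism `Q ⟶ V⟦1⟧`. -/
theorem ob_factors_through_connecting (ob : ∀ X : C, X ⟶ X⟦(2 : ℤ)⟧)
    (hob : ∀ {X Y : C} (f : X ⟶ Y), ob X ≫ f⟦(2 : ℤ)⟧' = f ≫ ob Y)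
    (T : Triangle C) (hT : T ∈ distTriang C) (hG : ob T.obj₂ = 0) :
    ∃ ζ : T.obj₁⟦(1 : ℤ)⟧ ⟶ T.obj₃⟦(2 : ℤ)⟧, ob T.obj₃ = T.mor₃ ≫ ζ := by
  apply Triangle.yoneda_exact₃ T hT
  rw [← hob T.mor₂, hG, zero_comp]

omit [HasZeroObject C] [∀ n : ℤ, (shiftFunctor C n).Additive] [Pretriangulated C] in
/-- **Block extraction.** Suppose `ob Q = Θ ≫ ζ`, and `J` is a direct summand of `Q` (`i ≫ p = 𝟙`) whose
composite with `Θ` decomposes as `i ≫ Θ = κ ≫ u + φ ≫ w` with `w : W ⟶ V₁` and `Hom(W, J⟦2⟧) = 0`.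
Then `ob J` factors through `κ`. (In THEOREM KP: `J = J'_P`, `κ` = the Koszul class, `W` = the successors'
entry lines, killed by the index-12 vanishing `Ext²(V_R, J'_P) = 0`.) -/
theorem ob_summand_eq_of_factors (ob : ∀ X : C, X ⟶ X⟦(2 : ℤ)⟧)
    (hob : ∀ {X Y : C} (f : X ⟶ Y), ob X ≫ f⟦(2 : ℤ)⟧' = f ≫ ob Y)
    {Q V₁ J K W : C} (Θ : Q ⟶ V₁) (ζ : V₁ ⟶ Q⟦(2 : ℤ)⟧)
    (hQ : ob Q = Θ ≫ ζ) (i : J ⟶ Q) (p : Q ⟶ J) (hip : i ≫ p = 𝟙 J)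
    (κ : J ⟶ K) (u : K ⟶ V₁) (φ : J ⟶ W) (w : W ⟶ V₁) (hΘ : i ≫ Θ = κ ≫ u + φ ≫ w)
    (hW : ∀ g : W ⟶ J⟦(2 : ℤ)⟧, g = 0) :
    ob J = κ ≫ (u ≫ ζ ≫ p⟦(2 : ℤ)⟧') := by
  have h1 : ob J = i ≫ ob Q ≫ p⟦(2 : ℤ)⟧' := by
    calc ob J = ob J ≫ (i ≫ p)⟦(2 : ℤ)⟧' := by
            rw [hip, CategoryTheory.Functor.map_id, Category.comp_id]
      _ = (ob J ≫ i⟦(2 : ℤ)⟧') ≫ p⟦(2 : ℤ)⟧' := by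
            rw [CategoryTheory.Functor.map_comp, Category.assoc]
      _ = i ≫ ob Q ≫ p⟦(2 : ℤ)⟧' := by rw [hob i, Category.assoc]
  have h2 : i ≫ (Θ ≫ ζ) ≫ p⟦(2 : ℤ)⟧' = (i ≫ Θ) ≫ ζ ≫ p⟦(2 : ℤ)⟧' := by
    simp only [Category.assoc]
  rw [h1, hQ, h2, hΘ, Preadditive.add_comp]
  simp only [Category.assoc]
  rw [hW (w ≫ ζ ≫ p⟦(2 : ℤ)⟧'), comp_zero, add_zero]

/-- **Steps (3)–(4) of THEOREM KP.** For a natural family `ob` and a distinguished triangle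
`V ⟶ F ⟶ J ⟶ V⟦1⟧` with `Hom(F, V⟦2⟧) = 0`: if `ob J` factors through the connecting morphism
`J ⟶ V⟦1⟧`, then `ob F = 0` (in THEOREM KP: `F = F_P = L_v ⊕ L_{v'}`, so both line bundles must
deform along `κ`). -/
theorem ob_eq_zero_of_pair (ob : ∀ X : C, X ⟶ X⟦(2 : ℤ)⟧)
    (hob : ∀ {X Y : C} (f : X ⟶ Y), ob X ≫ f⟦(2 : ℤ)⟧' = f ≫ ob Y)
    (T : Triangle C) (hT : T ∈ distTriang C)
    (hJ : ∃ ζ : T.obj₁⟦(1 : ℤ)⟧ ⟶ T.obj₃⟦(2 : ℤ)⟧, ob T.obj₃ = T.mor₃ ≫ ζ)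
    (hV : ∀ g : T.obj₂ ⟶ T.obj₁⟦(2 : ℤ)⟧, g = 0) :
    ob T.obj₂ = 0 := by
  obtain ⟨ζ, hζ⟩ := hJ
  -- `ob F ≫ π⟦2⟧ = π ≫ ob J = π ≫ mor₃ ≫ ζ = 0`
  have h0 : ob T.obj₂ ≫ T.mor₂⟦(2 : ℤ)⟧' = 0 := by
    rw [hob T.mor₂, hζ, ← Category.assoc, comp_distTriang_mor_zero₂₃ T hT, zero_comp]
  -- exactness of `Hom(F, -)` on the shifted triangle `V⟦2⟧ ⟶ F⟦2⟧ ⟶ J⟦2⟧`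
  have hT2 := Triangle.shift_distinguished T hT 2
  have h2 : (2 : ℤ).negOnePow = 1 := Int.negOnePow_even 2 ⟨1, rfl⟩
  obtain ⟨g, hg⟩ : ∃ g : T.obj₂ ⟶ T.obj₁⟦(2 : ℤ)⟧,
      ob T.obj₂ = g ≫ ((2 : ℤ).negOnePow • T.mor₁⟦(2 : ℤ)⟧') :=
    Triangle.coyoneda_exact₂ _ hT2 (ob T.obj₂) (by
      change ob T.obj₂ ≫ ((2 : ℤ).negOnePow • T.mor₂⟦(2 : ℤ)⟧') = 0
      rw [h2, one_smul]
      exact h0)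
  rw [hg, hV g, zero_comp]

end Summit.Ventures.HSemireg.KoszulPairObstruction
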